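import Summits.QuantumFields.YangMills.Theorems.LuscherReductionTwistedTraceScalingStiffTrialMeasurable
import HarnessLib

/-!
# The UPPER clause of the BO sub-target at POLYNOMIAL SCALES, unconditionally: `ValleyBOUpperAt L (β^{−p}) (β^{−q}) (1/2) N_B`
# (lane A of S-BASE, crux `TwistedTraceScaling` stmt-QuantumFields-20203; design note `pub/ym-fleet/ym-luscher-20007-p1/COARSE-DESIGN.md` §17)

With the scale functions `ρ = β^{−r}` (chart radius), `μ = β^{−m}` (spectral floor), `d = ρ²/4` (chart depth, `(1−d)⁻² − 1 ≤ ρ²`), `σ = 2η = 2β^{−q}`, lane B's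
Riccati chain (`valleyBOUpperAt_of_riccati`, `…ValleyBOUpper`), the measurability theorem (`measurable_stiffTrial_riccati`, `…StiffTrialMeasurable`) and the
scalar TAIL asymptotics proved here give
* ★★★ `valleyBOUpperAt_pow` — `0 < q`, `0 < r`, `2r < 1`, `0 < m`, `2r < q − m/2` ⟹ `ValleyBOUpperAt L (powScale p) (powScale q) (1/2) N_B` with
  `N_B β = riccatiN L β (β^{−r}) (2β^{−q}) (β^{−m})` — NO hypotheses left on the upper side.
Hence (`valleyBOWeakAt_of_upper_floor`, `coarseNoIntruderAt_of_boWeak_pow`): ★★★ `coarseNoIntruderAt_of_floor_pow` — COARSE-UPPER(L) ⇐ the k = 0 FLOOR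
`ValleyFloorAt L (powScale p) (1/2) N_B` (C3d with lane B's normalisation) + the one-orbit INNER NO-INTRUDER, for `0 < p < 1/3`, `4p < q < 8/9`, `0 < r < 1/2`, `0 < m`,
`2r < q − m/2`.
Tools: `eventually_rpow_dominates` (`C + k·log β + 4β^b ≤ β^a/2` eventually, `b < a`, `a > 0`), `inv_one_sub_sq_sub_one_le` (`(1−x)⁻² − 1 ≤ 4x` on `[0, 1/4]`).
HONEST FRAMING: real asymptotics + bookkeeping for a stub lane of a child of the CONDITIONAL reduction route (femto rung R2b1); the FLOOR is OPEN; not infinite volume,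
not a gap, not Clay.
-/

set_option autoImplicit false

noncomputable section

open MeasureTheory Real
open scoped BigOperators
open Literature.MathematicalPhysics.QuantumFieldTheory
open Literature.MathematicalPhysics.QuantumLattice

namespace Summit.QuantumFields.YangMills.Theorems.FemtoTransferGap

open TwoLattice TwoLattice.Toron TwoLattice.Cov TwoLattice.Stiff TwoLattice.Harm TwoLattice.GnChart

/-! ## §1 Two elementary lemmas -/

/-- `(1 − x)⁻² − 1 ≤ 4x` for `0 ≤ x ≤ 1/4`. [folklore] -/
theorem inv_one_sub_sq_sub_one_le {x : ℝ} (hx0 : 0 ≤ x) (hx : x ≤ 1 / 4) : ((1 - x) ^ 2)⁻¹ - 1 ≤ 4 * x := by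
  have h1 : 0 < (1 - x) ^ 2 := by nlinarith
  rw [sub_le_iff_le_add, inv_le_iff_one_le_mul₀ h1]
  nlinarith [mul_nonneg hx0 (by nlinarith : 0 ≤ 2 - 7 * x + 4 * x ^ 2)]

/-- ★ **Powers dominate logarithms and smaller powers**: for `a > 0`, `b < a` and any `k, C`, eventually `C + k·log β + 4β^b ≤ β^a/2` (and `β ≥ 1`). [folklore] -/
theorem eventually_rpow_dominates {a b k C : ℝ} (ha : 0 < a) (hb : b < a) :
    ∃ β0 : ℝ, ∀ β : ℝ, β0 ≤ β → 1 ≤ β ∧ C + k * Real.log β + 4 * β ^ b ≤ β ^ a / 2 := by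
  set K := max k 0 with hK
  set C' := max C 0 with hC'
  set s := a / 2 with hs
  have hs0 : 0 < s := by positivity
  set b' := max b s with hb'
  have hb'a : b' < a := max_lt hb (by rw [hs]; linarith)
  set M : ℝ := 4 * (K / s + 4) with hM
  have hM0 : 0 < M := by positivity
  have hgap : 0 < a - b' := by linarith
  refine ⟨max 1 (max ((4 * C' + 1) ^ a⁻¹) (M ^ (a - b')⁻¹)), fun β hβ => ?_⟩
  have hβ1 : 1 ≤ β := (le_max_left _ _).trans hβ
  have hβ0 : 0 < β := by linarith
  refine ⟨hβ1, ?_⟩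
  have hlog0 : 0 ≤ Real.log β := Real.log_nonneg hβ1
  -- `k log β ≤ K log β ≤ (K/s) β^s ≤ (K/s) β^{b'}`
  have h1 : k * Real.log β ≤ K * Real.log β := mul_le_mul_of_nonneg_right (le_max_left _ _) hlog0
  have h2 : K * Real.log β ≤ K / s * β ^ s := by
    have := Real.log_le_rpow_div hβ0.le hs0
    have hK0 : 0 ≤ K := le_max_right _ _
    calc K * Real.log β ≤ K * (β ^ s / s) := mul_le_mul_of_nonneg_left this hK0
      _ = K / s * β ^ s := by ring
  have hmono : ∀ {y z : ℝ}, y ≤ z → β ^ y ≤ β ^ z := fun h => Real.rpow_le_rpow_of_exponent_le hβ1 h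
  have h3 : β ^ s ≤ β ^ b' := hmono (le_max_right _ _)
  have h4 : β ^ b ≤ β ^ b' := hmono (le_max_left _ _)
  have hKs : 0 ≤ K / s := div_nonneg (le_max_right _ _) hs0.le
  -- `C ≤ C' ≤ β^a/4`
  have h5 : 4 * C' + 1 ≤ β ^ a := by
    have hle : (4 * C' + 1) ^ a⁻¹ ≤ β := ((le_max_left _ _).trans (le_max_right _ _)).trans hβ
    have hpos : 0 ≤ 4 * C' + 1 := by positivity
    have := Real.rpow_le_rpow (Real.rpow_nonneg hpos _) hle ha.le
    rwa [Real.rpow_inv_rpow hpos ha.ne'] at this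
  -- `M ≤ β^{a − b'}`, so `(K/s + 4) β^{b'} ≤ β^a/4`
  have h6 : M ≤ β ^ (a - b') := by
    have hle : M ^ (a - b')⁻¹ ≤ β := ((le_max_right _ _).trans (le_max_right _ _)).trans hβ
    have := Real.rpow_le_rpow (Real.rpow_nonneg hM0.le _) hle hgap.le
    rwa [Real.rpow_inv_rpow hM0.le hgap.ne'] at this
  have h7 : (K / s + 4) * β ^ b' ≤ β ^ a / 4 := by
    have hsplit : β ^ a = β ^ (a - b') * β ^ b' := by rw [← Real.rpow_add hβ0]; congr 1; ring
    rw [hsplit]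
    have hb0 : 0 ≤ β ^ b' := Real.rpow_nonneg hβ0.le _
    have := mul_le_mul_of_nonneg_right h6 hb0
    rw [hM] at this
    linarith
  have hC : C ≤ C' := le_max_left _ _
  nlinarith [h1, h2, h3, h4, h5, h7, mul_le_mul_of_nonneg_left h3 hKs]

variable {L : ℕ} [NeZero L]

/-! ## §2 Nonnegativity of lane B's error terms -/

/-- `stepRem ρ σ ≥ 0` for `ρ, σ ≥ 0`. [folklore] -/
theorem stepRem_nonneg' {ρ : ℝ} (σ : ℝ) (hρ : 0 ≤ ρ) : 0 ≤ stepRem ρ σ := by unfold stepRem; positivity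

/-- `stepErrLo ρ σ N ≥ 0` for `ρ, σ, N ≥ 0`. [folklore] -/
theorem stepErrLo_nonneg' {ρ : ℝ} (σ N : ℝ) (hρ : 0 ≤ ρ) : 0 ≤ stepErrLo ρ σ N := by
  have := stepRem_nonneg' σ hρ; unfold stepErrLo; positivity

/-- `chartErr ρ σ N ≥ 0` for `ρ, σ, N ≥ 0`. [folklore] -/
theorem chartErr_nonneg' {ρ : ℝ} (σ N : ℝ) (hρ : 0 ≤ ρ) : 0 ≤ chartErr ρ σ N := by unfold chartErr; positivity

/-- `trialErr ≥ 0` for nonnegative arguments. [folklore] -/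
theorem trialErr_nonneg' {ρ m m₁ Lc : ℝ} (σ N n : ℝ) (hρ : 0 ≤ ρ) (hm : 0 ≤ m) (hm₁ : 0 ≤ m₁) (hL : 0 ≤ Lc) :
    0 ≤ trialErr ρ σ N n m m₁ Lc := by
  have := stepRem_nonneg' σ hρ; unfold trialErr; positivity

/-- `riccatiPref ≥ (2π²)^{−|E|}·e^{2β|E|}` when the error exponents are nonnegative (`β, ρ, σ ≥ 0`, `μ > 0`). [folklore] -/
theorem riccatiPref_ge {β ρ μ : ℝ} (σ : ℝ) (hβ : 0 ≤ β) (hρ : 0 ≤ ρ) (hμ : 0 < μ) :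
    ((2 * π ^ 2)⁻¹) ^ Fintype.card (Edge 3 L) * Real.exp (2 * β) ^ Fintype.card (Edge 3 L) ≤ riccatiPref L β ρ σ μ := by
  unfold riccatiPref
  have hA : 0 ≤ β / 2 * (stepErrLo ρ σ (Fintype.card (Plaquette 3 L × Fin 3)) + chartErr ρ σ (Fintype.card (Plaquette 3 L × Fin 3))) := by
    have h1 := stepErrLo_nonneg' σ (Fintype.card (Plaquette 3 L × Fin 3) : ℝ) hρ
    have h2 := chartErr_nonneg' σ (Fintype.card (Plaquette 3 L × Fin 3) : ℝ) hρ
    positivity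
  have hB : 0 ≤ trialErr ρ σ (Fintype.card (Plaquette 3 L × Fin 3)) (Fintype.card (Edge 3 L × Fin 3))
      (Real.sqrt ((β / 2) ^ 2 + 2 * (β / 2) * (β / (1 + ρ ^ 2) ^ 2) / μ) / μ)
      (Real.sqrt ((β / 2) ^ 2 + 2 * (β / 2) * (β / (1 + ρ ^ 2) ^ 2) / μ))
      (3 * (β / 2) / μ ^ 2 + 3 * (β / (1 + ρ ^ 2) ^ 2) / μ ^ 3) :=
    trialErr_nonneg' _ _ _ hρ (by positivity) (Real.sqrt_nonneg _) (by positivity)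
  have h1 : 1 ≤ Real.exp (β / 2 * (stepErrLo ρ σ (Fintype.card (Plaquette 3 L × Fin 3)) + chartErr ρ σ (Fintype.card (Plaquette 3 L × Fin 3)))) :=
    Real.one_le_exp hA
  have h2 := Real.one_le_exp hB
  have h0 : 0 ≤ ((2 * π ^ 2)⁻¹) ^ Fintype.card (Edge 3 L) * Real.exp (2 * β) ^ Fintype.card (Edge 3 L) := by positivity
  calc ((2 * π ^ 2)⁻¹) ^ Fintype.card (Edge 3 L) * Real.exp (2 * β) ^ Fintype.card (Edge 3 L)
      = ((2 * π ^ 2)⁻¹) ^ Fintype.card (Edge 3 L) * Real.exp (2 * β) ^ Fintype.card (Edge 3 L) * 1 * 1 := by ring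
    _ ≤ _ := by gcongr

/-- `riccatiGauss ≥ β^{−3|E|/2}` for `β ≥ 1`, `μ ≥ 0`. [folklore] -/
theorem riccatiGauss_ge {β ρ μ : ℝ} (hβ : 1 ≤ β) (hμ : 0 ≤ μ) :
    β ^ (-(((Fintype.card (Edge 3 L) * 3 : ℕ) : ℝ) / 2)) ≤ riccatiGauss L β ρ μ := by
  unfold riccatiGauss
  have hβ0 : 0 < β := by linarith
  -- `√(π/b') ≥ β^{−1/2}`
  have hb' : 0 < β / (1 + ρ ^ 2) ^ 2 := by positivity
  have h1 : β⁻¹ ≤ Real.pi / (β / (1 + ρ ^ 2) ^ 2) := by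
    rw [div_div_eq_mul_div, le_div_iff₀ hβ0]
    have hπ : 1 ≤ Real.pi := by linarith [Real.pi_gt_three]
    have h2 : 1 ≤ (1 + ρ ^ 2) ^ 2 := by nlinarith [sq_nonneg ρ]
    rw [inv_mul_cancel₀ hβ0.ne']
    nlinarith
  have h2 : β ^ (-(1 / 2 : ℝ)) ≤ Real.sqrt (Real.pi / (β / (1 + ρ ^ 2) ^ 2)) := by
    have := Real.sqrt_le_sqrt h1
    rwa [Real.sqrt_eq_rpow, Real.inv_rpow hβ0.le, ← Real.rpow_neg hβ0.le] at this
  have h3 : β ^ (-(((Fintype.card (Edge 3 L) * 3 : ℕ) : ℝ) / 2)) = (β ^ (-(1 / 2 : ℝ))) ^ (Fintype.card (Edge 3 L) * 3) := by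
    rw [← Real.rpow_natCast, ← Real.rpow_mul hβ0.le]; congr 1; ring
  rw [h3]
  have h4 : 1 ≤ Real.exp (((Fintype.card (Edge 3 L) * 3 : ℕ) : ℝ) * modeZPE (β / 2 * μ / (β / (1 + ρ ^ 2) ^ 2))) :=
    Real.one_le_exp (mul_nonneg (Nat.cast_nonneg _) (modeZPE_nonneg (by positivity)))
  calc (β ^ (-(1 / 2 : ℝ))) ^ (Fintype.card (Edge 3 L) * 3) ≤ Real.sqrt (Real.pi / (β / (1 + ρ ^ 2) ^ 2)) ^ (Fintype.card (Edge 3 L) * 3) :=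
        pow_le_pow_left₀ (Real.rpow_nonneg hβ0.le _) h2 _
    _ = Real.sqrt (Real.pi / (β / (1 + ρ ^ 2) ^ 2)) ^ (Fintype.card (Edge 3 L) * 3) * 1 := (mul_one _).symm
    _ ≤ _ := mul_le_mul_of_nonneg_left h4 (by positivity)

/-- `ĝ = √(t² + 2tb'/μ) ≤ 2β^{1+m/2}` at `t = β/2`, `b' ≤ β`, `μ = β^{−m}`, `β ≥ 1`, `m ≥ 0`. [folklore] -/
theorem ghat_le {β ρ m : ℝ} (hβ : 1 ≤ β) (hm : 0 ≤ m) :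
    Real.sqrt ((β / 2) ^ 2 + 2 * (β / 2) * (β / (1 + ρ ^ 2) ^ 2) / β ^ (-m)) ≤ 2 * β ^ (1 + m / 2) := by
  have hβ0 : 0 < β := by linarith
  have hb' : β / (1 + ρ ^ 2) ^ 2 ≤ β := div_le_self hβ0.le (by nlinarith [sq_nonneg ρ])
  have hb'0 : 0 ≤ β / (1 + ρ ^ 2) ^ 2 := by positivity
  have hμ : β ^ (-m) = (β ^ m)⁻¹ := Real.rpow_neg hβ0.le m
  have hβm : 1 ≤ β ^ m := Real.one_le_rpow hβ hm
  have hP : 0 < β ^ (1 + m / 2) := Real.rpow_pos_of_pos hβ0 _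
  have hsq : (β ^ (1 + m / 2)) ^ 2 = β ^ 2 * β ^ m := by
    rw [← Real.rpow_natCast, ← Real.rpow_mul hβ0.le, show (1 + m / 2) * ((2 : ℕ) : ℝ) = 2 + m by push_cast; ring, Real.rpow_add hβ0,
      Real.rpow_two]
  rw [Real.sqrt_le_left (by positivity)]
  rw [hμ, div_inv_eq_mul]
  have h1 : 2 * (β / 2) * (β / (1 + ρ ^ 2) ^ 2) * β ^ m ≤ β ^ 2 * β ^ m := by
    have : 2 * (β / 2) * (β / (1 + ρ ^ 2) ^ 2) ≤ β ^ 2 := by nlinarith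
    exact mul_le_mul_of_nonneg_right this (by positivity)
  have h2 : (β / 2) ^ 2 ≤ β ^ 2 * β ^ m := by nlinarith [sq_nonneg β]
  nlinarith [hsq]

/-! ## §3 ★★★ The UPPER clause at polynomial scales -/

/-- ★★★ **UPPER(N_B) AT POLYNOMIAL SCALES, UNCONDITIONALLY**: for `0 < q`, `0 < r`, `2r < 1`, `0 < m`, `2r < q − m/2` (chart radius `ρ = β^{−r}`, spectral floor
`μ = β^{−m}`, chart depth `d = ρ²/4`), `ValleyBOUpperAt L (powScale p) (powScale q) (1/2) (β ↦ riccatiN L β (powScale r β) (2·powScale q β) (powScale m β))`.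
[cite: Luscher1983, §3] [cite: Wipf2021, §8.5.2] -/
theorem valleyBOUpperAt_pow {p q r m : ℝ} (hq : 0 < q) (hr : 0 < r) (hr1 : 2 * r < 1) (hm : 0 < m) (hrq : 2 * r < q - m / 2) :
    ValleyBOUpperAt L (powScale p) (powScale q) (1 / 2) (fun β => riccatiN L β (powScale r β) (2 * powScale q β) (powScale m β)) := by
  -- abbreviations
  set E : ℕ := Fintype.card (Edge 3 L) with hE
  set n : ℕ := Fintype.card (Edge 3 L) * 3 with hn
  set NP : ℕ := Fintype.card (Plaquette 3 L × Fin 3) with hNP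
  set Zmax : ℝ := (n : ℝ) * modeZPE (1 / 2 * (10 * Real.sqrt NP) ^ 2) with hZ
  refine valleyBOUpperAt_of_riccati (powScale r) (powScale m) (fun β => powScale r β ^ 2 / 4) ?_ ?_
  · -- lane B's hypotheses, eventually
    obtain ⟨β1, h1⟩ := rpow_neg_eventually_le hr (M := 1 / 100) (by norm_num)
    obtain ⟨β2, h2⟩ := rpow_neg_eventually_le hq (M := 1 / 32) (by norm_num)
    refine ⟨max β1 β2, fun β hβ => ?_⟩
    obtain ⟨hβ1, hρ⟩ := h1 β ((le_max_left _ _).trans hβ)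
    obtain ⟨-, hη⟩ := h2 β ((le_max_right _ _).trans hβ)
    have hβ0 : 0 < β := by linarith
    rw [← powScale_eq hβ1] at hρ hη
    have hρ0 : 0 ≤ powScale r β := (powScale_pos r β).le
    have hρ2 : powScale r β ^ 2 ≤ 1 := by nlinarith
    have hd0 : 0 ≤ powScale r β ^ 2 / 4 := by positivity
    have hd4 : powScale r β ^ 2 / 4 ≤ 1 / 4 := by linarith
    refine ⟨hβ0, by linarith, hρ0, hρ, ?_, powScale_pos q β, by linarith, powScale_pos m β,
      measurable_stiffTrial_riccati _ _ (powScale_pos m β)⟩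
    have := inv_one_sub_sq_sub_one_le hd0 hd4
    linarith
  · -- the TAIL condition
    intro ε hε
    set a : ℝ := 1 - 2 * r with ha
    set b : ℝ := 1 + m / 2 - q with hb
    have ha0 : 0 < a := by rw [ha]; linarith
    have hba : b < a := by rw [ha, hb]; linarith
    set k : ℝ := (n : ℝ) / 2 + p with hk
    set C : ℝ := (E : ℝ) * Real.log (2 * π ^ 2) - Real.log ε + Zmax with hC
    obtain ⟨βA, hA⟩ := eventually_rpow_dominates (k := k) (C := C) ha0 hba
    refine ⟨βA, fun β hβ => ?_⟩
    obtain ⟨hβ1, hdom⟩ := hA β hβ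
    have hβ0 : 0 < β := by linarith
    -- the scales at `β ≥ 1`
    have hρ : powScale r β = β ^ (-r) := powScale_eq hβ1
    have hμ : powScale m β = β ^ (-m) := powScale_eq hβ1
    have hη : powScale q β = β ^ (-q) := powScale_eq hβ1
    have hδ : powScale p β = β ^ (-p) := powScale_eq hβ1
    rw [hρ, hμ, hη, hδ]
    have hρ0 : 0 ≤ β ^ (-r) := Real.rpow_nonneg hβ0.le _
    have hσ0 : 0 ≤ 2 * β ^ (-q) := by positivity
    have hμ0 : 0 < β ^ (-m) := Real.rpow_pos_of_pos hβ0 _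
    -- (1) `2β·d = β^a/2`
    have hd : 2 * β * ((β ^ (-r)) ^ 2 / 4) = β ^ a / 2 := by
      rw [← Real.rpow_natCast, ← Real.rpow_mul hβ0.le, ha]
      have : β * β ^ (-r * ((2 : ℕ) : ℝ)) = β ^ (1 - 2 * r) := by
        rw [show (1 : ℝ) - 2 * r = 1 + -r * ((2 : ℕ) : ℝ) by push_cast; ring, Real.rpow_add hβ0, Real.rpow_one]
      rw [← this]; ring
    -- (2) the normalisation from below
    have hN : ((2 * π ^ 2)⁻¹) ^ E * Real.exp (2 * β) ^ E * β ^ (-((n : ℝ) / 2)) ≤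
        riccatiN L β (β ^ (-r)) (2 * β ^ (-q)) (β ^ (-m)) := by
      unfold riccatiN
      exact mul_le_mul (riccatiPref_ge _ hβ0.le hρ0 hμ0) (riccatiGauss_ge hβ1 hμ0.le) (Real.rpow_nonneg hβ0.le _)
        (riccatiPref_pos _ _ _ _).le
    -- (3) `ĝ·2η ≤ 4β^b`
    have hg : Real.sqrt ((β / 2) ^ 2 + 2 * (β / 2) * (β / (1 + (β ^ (-r)) ^ 2) ^ 2) / β ^ (-m)) * (2 * β ^ (-q)) ≤ 4 * β ^ b := by
      have h1 := ghat_le (ρ := β ^ (-r)) hβ1 hm.le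
      have hq0 : 0 ≤ 2 * β ^ (-q) := hσ0
      calc _ ≤ 2 * β ^ (1 + m / 2) * (2 * β ^ (-q)) := mul_le_mul_of_nonneg_right h1 hq0
        _ = 4 * (β ^ (1 + m / 2) * β ^ (-q)) := by ring
        _ = 4 * β ^ b := by rw [← Real.rpow_add hβ0, hb]; ring_nf
    -- (4) rewrite the explicit lower bound in exponential form
    have hexpform : ((2 * π ^ 2)⁻¹) ^ E * Real.exp (2 * β) ^ E * β ^ (-((n : ℝ) / 2)) * (ε * β ^ (-p)) * Real.exp (-Zmax) * Real.exp (-(4 * β ^ b)) =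
        Real.exp (2 * β) ^ E * Real.exp (-(C + k * Real.log β + 4 * β ^ b)) := by
      have hπ2 : 0 < 2 * π ^ 2 := by positivity
      have e1 : ((2 * π ^ 2)⁻¹) ^ E = Real.exp (-((E : ℝ) * Real.log (2 * π ^ 2))) := by
        rw [← Real.exp_log (inv_pos.2 hπ2), ← Real.exp_nat_mul, Real.log_inv]; ring_nf
      have e2 : β ^ (-((n : ℝ) / 2)) * β ^ (-p) = Real.exp (-(k * Real.log β)) := by
        rw [← Real.rpow_add hβ0, Real.rpow_def_of_pos hβ0, hk]; ring_nf
      have e3 : ε = Real.exp (Real.log ε) := (Real.exp_log hε).symm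
      calc ((2 * π ^ 2)⁻¹) ^ E * Real.exp (2 * β) ^ E * β ^ (-((n : ℝ) / 2)) * (ε * β ^ (-p)) * Real.exp (-Zmax) * Real.exp (-(4 * β ^ b))
          = Real.exp (2 * β) ^ E * (((2 * π ^ 2)⁻¹) ^ E * (β ^ (-((n : ℝ) / 2)) * β ^ (-p)) * ε * Real.exp (-Zmax) * Real.exp (-(4 * β ^ b))) := by ring
        _ = Real.exp (2 * β) ^ E * Real.exp (-(C + k * Real.log β + 4 * β ^ b)) := by
            rw [e1, e2]
            conv_lhs => rw [e3]
            simp only [← Real.exp_add]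
            congr 1
            rw [hC]; ring_nf
    -- (5) assemble
    have hLHS : Real.exp (2 * β) ^ E * Real.exp (-(2 * β * ((β ^ (-r)) ^ 2 / 4))) = Real.exp (2 * β) ^ E * Real.exp (-(β ^ a / 2)) := by
      rw [hd]
    rw [hLHS]
    have hstep1 : Real.exp (2 * β) ^ E * Real.exp (-(β ^ a / 2)) ≤ Real.exp (2 * β) ^ E * Real.exp (-(C + k * Real.log β + 4 * β ^ b)) :=
      mul_le_mul_of_nonneg_left (Real.exp_le_exp.2 (by linarith)) (by positivity)
    refine hstep1.trans ?_
    rw [← hexpform]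
    -- compare factor by factor with the right-hand side
    have hε0 : 0 ≤ ε * β ^ (-p) := by positivity
    have hT1 : Real.exp (-(4 * β ^ b)) ≤
        Real.exp (-(Real.sqrt ((β / 2) ^ 2 + 2 * (β / 2) * (β / (1 + (β ^ (-r)) ^ 2) ^ 2) / β ^ (-m)) * (2 * β ^ (-q)))) :=
      Real.exp_le_exp.2 (neg_le_neg hg)
    have hZ' : Real.exp (-Zmax) = Real.exp (-((n : ℝ) * modeZPE (1 / 2 * (10 * Real.sqrt NP) ^ 2))) := by rw [hZ]
    calc ((2 * π ^ 2)⁻¹) ^ E * Real.exp (2 * β) ^ E * β ^ (-((n : ℝ) / 2)) * (ε * β ^ (-p)) * Real.exp (-Zmax) * Real.exp (-(4 * β ^ b))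
        ≤ riccatiN L β (β ^ (-r)) (2 * β ^ (-q)) (β ^ (-m)) * (ε * β ^ (-p)) * Real.exp (-Zmax) *
            Real.exp (-(Real.sqrt ((β / 2) ^ 2 + 2 * (β / 2) * (β / (1 + (β ^ (-r)) ^ 2) ^ 2) / β ^ (-m)) * (2 * β ^ (-q)))) := by
          have hR0 : 0 ≤ riccatiN L β (β ^ (-r)) (2 * β ^ (-q)) (β ^ (-m)) * (ε * β ^ (-p)) * Real.exp (-Zmax) :=
            mul_nonneg (mul_nonneg (riccatiN_pos hβ0 _ _ _).le hε0) (Real.exp_pos _).le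
          gcongr
    _ = _ := by rw [hZ', hn, hNP]

/-! ## §4 ★★★ COARSE-UPPER(L) from the FLOOR alone -/

/-- ★★★ **END TO END FROM THE k = 0 FLOOR**: for `0 < p < 1/3`, `4p < q < 8/9`, `0 < r`, `2r < 1`, `0 < m`, `2r < q − m/2`: the FLOOR
`ValleyFloorAt L (β^{−p}) (1/2) N_B` (C3d with lane B's normalisation at the scales `ρ = β^{−r}`, `σ = 2β^{−q}`, `μ = β^{−m}`) and the one-orbit INNER NO-INTRUDER give
COARSE-UPPER(L). [cite: Luscher1983, §3] [cite: LuscherMunster1984, §2] -/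
theorem coarseNoIntruderAt_of_floor_pow {p q r m : ℝ} (hp0 : 0 < p) (hp : p < 1 / 3) (hpq : 4 * p < q) (hq : q < 8 / 9) (hr : 0 < r) (hr1 : 2 * r < 1)
    (hm : 0 < m) (hrq : 2 * r < q - m / 2)
    (hF : ValleyFloorAt L (powScale p) (1 / 2) (fun β => riccatiN L β (powScale r β) (2 * powScale q β) (powScale m β)))
    (hI : InnerNoIntruderOneOrbitAt L (powScale p)) :
    ∀ k : ℕ, ∀ d : ℝ, d < levelGap k → ∃ lam0 : ℝ, 0 < lam0 ∧ ∀ lam : ℝ, 0 < lam → lam ≤ lam0 →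
      ∀ β : ℝ, InFemtoWindow lam β L →
        levelValue su2Rep L β k ≤ Real.exp (-(d * luscherLambda β L) / L) * levelValue su2Rep L β 0 := by
  have hq0 : 0 < q := by linarith
  refine coarseNoIntruderAt_of_boWeak_pow hp0 hp hpq hq ?_ hI
  -- the floor's `N` must be positive where used: `ValleyFloorAt` only needs it eventually; recombine via an eventually-positive modification
  have hU := valleyBOUpperAt_pow (L := L) (p := p) hq0 hr hr1 hm hrq
  -- `riccatiN > 0` for `β > 0`; for `β ≤ 0` replace `N` by `1` harmlessly (both clauses are eventual): use `N' β = riccatiN L (max β 1) …`? Simpler: both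
  -- properties are stated for all large `β`, so restrict to `β ≥ 1` inside the recombination.
  refine ⟨1 / 2, by norm_num, fun ε hε => ?_⟩
  obtain ⟨βU, hβU⟩ := hU ε hε
  obtain ⟨βF, hβF⟩ := hF ε hε
  refine ⟨max 1 (max βU βF), fun β hβ => ?_⟩
  have hβ1 : 1 ≤ β := (le_max_left _ _).trans hβ
  have hβ0 : 0 < β := by linarith
  refine ⟨riccatiN L β (powScale r β) (2 * powScale q β) (powScale m β), riccatiN_pos hβ0 _ _ _,
    hβF β ((le_max_right _ _).trans ((le_max_right _ _).trans hβ)), ?_⟩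
  obtain ⟨h, c, Ch, hhm, hc, hh0, hhC, hhc, hrow⟩ := hβU β ((le_max_left _ _).trans ((le_max_right _ _).trans hβ))
  exact ⟨h, c, Ch, hhm, hc, hh0, hhC, hhc, hrow⟩

end Summit.QuantumFields.YangMills.Theorems.FemtoTransferGap

end
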